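import Mathlib
import HarnessLib
import Summits.HubbardSuperconductivity.HubbardSuperconductivity.Theorems.KLProgrammeKLRegimeSplitBundleV6
import Summits.HubbardSuperconductivity.HubbardSuperconductivity.Theorems.KLProgrammeKLRegimeSplitLegStaging

/-!
# Route `KLProgramme` — crux K3 `KLRegimeTwoPointLimit` (stmt-HubbardSuperconductivity-19937): the two-leg VOLUME-RATE clause (E3f) and the
# bundle `klPredsV7 := { FrameOK, RenormalisedAtF, BetaSplitAtS2, EngineBoundsAtV5S, TwoLegStepV7 }` (defects Δ14 + p1's Δ15, seat p2 g4,
# 2026-08-26; plan g10 rulings 13:42:56Z / 13:52:24Z)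

Δ14 = the mechanism of hubbard-kl-r2d-p2's Δ-asm (A), for CHILD 2.  `CountertermP2 Pr W` concludes ONE admissible frame `K`, chosen BEFORE the
volume (plan g9 Δ1: volume-uniform frame), renormalised at every `L ≥ Lc`, `M ≥ Mc L`.  Child 2 builds `K` as a fixed point of the
counterterm map `T_{L,M}(K) = P(K) ⊖ D_N(K)` whose pieces are FINITE-VOLUME objects; a single frame serving all large volumes needs the
finite-volume fixed points `K*_{L,M}` to be CAUCHY in the volume (then `K := K*_{L₀,M₀}` for one large `(L₀, M₀)` is within the deepest
tolerance of every later `K*_{L,M}`), i.e. it needs a TWO-VOLUME comparison of the local parts `ν_n^{L,M}(K)(θ)` — and every slot of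
`klPredsV6` is a statement at ONE volume `(L, M)` (sizes, floor, Lipschitz in `K`, slopes).  Data oscillating with `L` inside the (E3a)
sizes are consistent with all of them and defeat any single `K` (oscillation `≍ S₀U` at scale `0` against the tolerance `cr·U·e₀`).  So
`CountertermP2 klPredsV6 W` is not provable from its hypotheses by a child-2 prover (re-deriving volume convergence = re-building the engine),
exactly as child 4 was not before `VolumeLimitP`.

REPAIR (one conjunct in the two-leg slot; engine output; `Q.CL β n / L` is Part 1's «finite-volume evaluation error» field, `Q.M0 β L` its
Matsubara threshold): (E3f) `TwoLegVolumeRate hist Q … L M … K n` — the scale-`n` local part read on the frame's curve at volume `(L, M)` is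
within `Q.CL β n / L` of its value at every LARGER volume `(L′, M′)`, `L ≤ L′`, `Q.M0 β L′ ≤ M′`, AT WHICH THE FRAME CARRIES THE HISTORY
`hist L′ M′ K j`, `j < n` (plan g10 13:52:24Z: the engine's own `HistP` is at `(L, M)` only; a slot body may quantify over other volumes — it
is still a predicate AT `(L, M)`).  With it child 2's route is: finite-volume fixed points (self-map from (E3a-G), contraction from (E3c-G)),
`|K*_{L,M} − K*_{L′,M′}| ≤ (1−q)⁻¹ Σ_n CL β n / L`, `K := K*_{L₀,M₀}` with `Σ_n CL β n / L₀` below a quarter of the deepest tolerance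
`cr·U·Λ_{n_β}²/e₀`, renormalisation at all `L ≥ L₀` by (E3c-G) — the interpolation-grid dependence of `klFrameExtG` between volumes is
elementary (angular derivative bounds from (E3a-G)), no model input.  Δ15 (p1 g5 13:52:28Z, texts p450191
`…SplitLegStaging`): the leg-dressing constant of the ladder / value-increment clauses must be `Q`-level (`legDressBarQ`) and the pair-array
tolerance `Q`-aware (`PairArrayAtV2`) — engine slot `EngineBoundsAtV5S`, split slot `BetaSplitAtS2`.  Hence the bundle:
`histV7 := BetaSplitAtS2 ∧ RenormalisedAtF ∧ EngineBoundsAtV5S` (slot-derived: ONE `histV7_of_histP` serves (E3c-G) and (E3f)),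
`TwoLegStepV7 := TwoLegStepG histV7 ∧ TwoLegVolumeRate (histV7 ∧ TwoLegStepG histV7)` (the (E3f) antecedent = the full
non-self history at the comparison volume), `klPredsV7 := { frameOK := FrameOK, renorm := RenormalisedAtF,
split := BetaSplitAtS2, engine := EngineBoundsAtV5S, twoLeg := TwoLegStepV7 }`.  Children of record at V7: `EngineP3 | BetaSplitP |
CountertermP2 | VolumeLimitP (FinalTwoLegVolLimit) | TwoPointAssemblyP3 (FinalTwoLegVolLimit)` applied to `klPredsV7 klWindowC`
(`…SplitGenericV3`); glue `KLRegimeInductionV7P3` (`…SplitGlueV7P3`).  Definitions (+ `rfl` lemmas) only; nothing is asserted about the model.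
-/

noncomputable section

namespace Summit.HubbardSuperconductivity.HubbardSuperconductivity.Theorems.KLRegimeSplit

set_option linter.dupNamespace false -- summit = problem name (single-conjunct summit), D-0017

open Real Finset Literature.MathematicalPhysics.QuantumLattice Literature.Probability.LatticeModels
open Summit.HubbardSuperconductivity.HubbardSuperconductivity.Theorems.KLProgrammeLegKernels

section Model

variable (L M : ℕ) [NeZero L] [NeZero M]

/-- **(E3f) `TwoLegVolumeRate Q … L M … K n`** — the finite-volume convergence RATE of the scale-`n` local part: at every larger volume
`(L′, M′)` (`L ≤ L′`, `Q.M0 β L′ ≤ M′`) the local part of the frame `K` on its own Fermi curve differs from the one at `(L, M)` by at most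
`Q.CL β n / L`, uniformly in the angle — provided the slot's own Matsubara cutoff is beyond the engine's threshold, `Q.M0 β L ≤ M` (plan g10
13:42:56Z (2)(i)), AND provided the frame carries the HISTORY `hist L′ M′ K j` at the comparison volume for every `j < n` (plan g10 13:52:24Z:
the engine at `(L, M)` holds `HistP` at its own volume only; the scale-`n` local part at `(L′, M′)` is controlled through the expansion AT
`(L′, M′)`, which needs the split / renormalisation / engine bounds below `n` there — in the glue all volumes advance together, so child 2 has
it: `histV6_of_histP_V7` at `(L′, M′)`; the `FrameLipschitzG hist` pattern, same frame, other volume).  ENGINE OUTPUT (termwise volume convergence of the scale-`n` step's two-leg value, BGM's «termwise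
limits of the finite-`L` recursions»; Riemann sums of scale-`n` integrands at fixed `β`); child 2's INPUT for the volume-uniform frame (Δ14). -/
def TwoLegVolumeRate (hist : (L' M' : ℕ) → [NeZero L'] → [NeZero M'] → TrigPolyC4v → ℕ → Prop) (Q : EngConsts) (β U μ : ℝ)
    (K : TrigPolyC4v) (n : ℕ) : Prop :=
  Q.M0 β L ≤ M → ∀ (L' M' : ℕ) [NeZero L'] [NeZero M'], L ≤ L' → Q.M0 β L' ≤ M' →
    (∀ j < n, hist L' M' K j) →
      ∀ θ : ℝ, |klLocalPart L M β U μ K n θ - klLocalPart L' M' β U μ K n θ| ≤ Q.CL β n / L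

/-- **The comparison-frame / comparison-volume history of the V7 bundle** at scale `j`: `BetaSplitAtS2 ∧ RenormalisedAtF ∧
EngineBoundsAtV5S` (= this bundle's `split ∧ renorm ∧ engine`, so `HistP klPredsV7` discharges it at any volume: `histV7_of_histP`). -/
def histV7 (G : GeoConsts) (P : SplitConsts) (Q : EngConsts) (R : RenConsts) (β U μ : ℝ) : TrigPolyC4v → ℕ → Prop :=
  fun K' j => BetaSplitAtS2 L M G P Q β U μ K' j ∧ RenormalisedAtF L M β U μ K' R j ∧ EngineBoundsAtV5S L M G P Q β U μ K' j

/-- **`TwoLegStepV7 … G P Q R K n`** := `TwoLegStepG histV7 ∧ TwoLegVolumeRate (histV7 ∧ TwoLegStepG histV7)` — the «G» two-leg step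
(two-tier sizes, floor, frame-Lipschitz, slopes; `…SplitBundleV6`) read at the V7 history, plus the volume rate (E3f) whose comparison-volume
antecedent is the FULL non-self history at `(L′, M′)` below `n`: split ∧ renorm ∧ engine (`histV7`) AND the «G» two-leg step there (so the
engine at `(L, M)` holds at `(L′, M′)` everything its expansion reads — the volume-rate clause itself excluded, no self-reference; child 2
discharges it from its all-volumes hypothesis block: `twoLegStepG_of_twoLegStepV7`).  Same slot type as `Preds.twoLeg`. -/
def TwoLegStepV7 (G : GeoConsts) (P : SplitConsts) (Q : EngConsts) (R : RenConsts) (β U μ : ℝ) (K : TrigPolyC4v) (n : ℕ) :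
    Prop :=
  TwoLegStepG L M (histV7 L M G P Q R β U μ) G P Q R β U μ K n ∧
    TwoLegVolumeRate L M
      (fun L' M' _ _ K' j => histV7 L' M' G P Q R β U μ K' j ∧ TwoLegStepG L' M' (histV7 L' M' G P Q R β U μ) G P Q R β U μ K' j)
      Q β U μ K n

end Model

/-- **`klPredsV7 : Preds`** := `{ frameOK := FrameOK, renorm := RenormalisedAtF, split := BetaSplitAtS2, engine := EngineBoundsAtV5S,
twoLeg := TwoLegStepV7 }` — V6 (p1b p448032) with p1's `Q`-staged engine/split slots (Δ15, p450191) and the two-leg slot extended by (E3f)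
(Δ14).  Children of record (`…SplitGenericV3`):
`EngineP3 klPredsV7 klWindowC`, `BetaSplitP klPredsV7 klWindowC`, `CountertermP2 klPredsV7 klWindowC`,
`VolumeLimitP klPredsV7 FinalTwoLegVolLimit klWindowC`, `TwoPointAssemblyP3 klPredsV7 FinalTwoLegVolLimit klWindowC`. -/
def klPredsV7 : Preds where
  frameOK := FrameOK
  renorm := fun L M _ _ β U μ K R n => RenormalisedAtF L M β U μ K R n
  split := fun L M _ _ G P Q β U μ K n => BetaSplitAtS2 L M G P Q β U μ K n
  engine := fun L M _ _ G P Q β U μ K n => EngineBoundsAtV5S L M G P Q β U μ K n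
  twoLeg := fun L M _ _ G P Q R β U μ K n => TwoLegStepV7 L M G P Q R β U μ K n

/-! ## Bookkeeping (`rfl`-level) -/

/-- V7's frame class IS V6's (`FrameOK`). -/
theorem klPredsV7_frameOK : klPredsV7.frameOK = klPredsV6.frameOK := rfl

/-- V7's renormalisation slot IS V6's (`RenormalisedAtF`). -/
theorem klPredsV7_renorm : klPredsV7.renorm = klPredsV6.renorm := rfl

/-- V7's split slot is `BetaSplitAtS2`. -/
theorem klPredsV7_split (L M : ℕ) [NeZero L] [NeZero M] (G : GeoConsts) (P : SplitConsts) (Q : EngConsts) (β U μ : ℝ)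
    (K : TrigPolyC4v) (n : ℕ) : klPredsV7.split L M G P Q β U μ K n = BetaSplitAtS2 L M G P Q β U μ K n := rfl

/-- V7's engine slot is `EngineBoundsAtV5S`. -/
theorem klPredsV7_engine (L M : ℕ) [NeZero L] [NeZero M] (G : GeoConsts) (P : SplitConsts) (Q : EngConsts) (β U μ : ℝ)
    (K : TrigPolyC4v) (n : ℕ) : klPredsV7.engine L M G P Q β U μ K n = EngineBoundsAtV5S L M G P Q β U μ K n := rfl

/-- V7's two-leg slot is `TwoLegStepV7`. -/
theorem klPredsV7_twoLeg (L M : ℕ) [NeZero L] [NeZero M] (G : GeoConsts) (P : SplitConsts) (Q : EngConsts) (R : RenConsts)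
    (β U μ : ℝ) (K : TrigPolyC4v) (n : ℕ) :
    klPredsV7.twoLeg L M G P Q R β U μ K n = TwoLegStepV7 L M G P Q R β U μ K n := rfl

/-- The V7 history at `j` IS the three V7 slots at `j`: `HistP klPredsV7 … n` (at any volume) yields `histV7 … K j` for every `j < n` —
child 2 discharges both (E3c-G)'s comparison-frame antecedent and (E3f)'s comparison-volume antecedent with it. -/
theorem histV7_of_histP {L M : ℕ} [NeZero L] [NeZero M] {G : GeoConsts} {P : SplitConsts} {Q : EngConsts} {R : RenConsts}
    {β U μ : ℝ} {K : TrigPolyC4v} {n : ℕ} (h : HistP klPredsV7 L M G P Q R β U μ K n) :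
    ∀ j < n, histV7 L M G P Q R β U μ K j := fun j hj =>
  ⟨(h j hj).1, (h j hj).2.1, (h j hj).2.2.1⟩

/-- The «G» two-leg step is the first conjunct of the V7 two-leg slot (what the (E3f) antecedent asks at the comparison volume). -/
theorem twoLegStepG_of_twoLegStepV7 {L M : ℕ} [NeZero L] [NeZero M] {G : GeoConsts} {P : SplitConsts} {Q : EngConsts} {R : RenConsts}
    {β U μ : ℝ} {K : TrigPolyC4v} {n : ℕ} (h : TwoLegStepV7 L M G P Q R β U μ K n) :
    TwoLegStepG L M (histV7 L M G P Q R β U μ) G P Q R β U μ K n := h.1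

/-- `HistP klPredsV7` below `n` yields the full (E3f) antecedent at that volume: `histV7 ∧ TwoLegStepG histV7` at every `j < n`. -/
theorem histRate_of_histP {L M : ℕ} [NeZero L] [NeZero M] {G : GeoConsts} {P : SplitConsts} {Q : EngConsts} {R : RenConsts}
    {β U μ : ℝ} {K : TrigPolyC4v} {n : ℕ} (h : HistP klPredsV7 L M G P Q R β U μ K n) :
    ∀ j < n, histV7 L M G P Q R β U μ K j ∧ TwoLegStepG L M (histV7 L M G P Q R β U μ) G P Q R β U μ K j := fun j hj =>
  ⟨⟨(h j hj).1, (h j hj).2.1, (h j hj).2.2.1⟩, (h j hj).2.2.2.1⟩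

end Summit.HubbardSuperconductivity.HubbardSuperconductivity.Theorems.KLRegimeSplit

end
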